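import Summits.Langlands.Langlands.Theorems.IrreducibilityBySelfDualityIrreducibleOffSectorCliffordCyclic
import Summits.Langlands.Langlands.Theorems.IrreducibilityBySelfDualityIrreducibleOffSectorCyclicGaloisPresentation
import Literature.NumberTheory.GaloisRepresentations.RestrictFieldSemisimple
import Mathlib.Data.Int.GCD
import HarnessLib

/-!
# Irreducibility under restriction to `Γ_L` for a cyclic extension `L/K`: Clifford's dichotomy
(crux stmt-Langlands-14329 `IrreducibilityBySelfDuality.IrreducibleOffSector`, line `Sketch`;
`--supports` file, STRUCTURAL: Galois side of the BASE-CHANGE ASCENT operator; continuation lead c7)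

Galois form of `clifford_cyclic` (`…IrreducibleOffSectorCliffordCyclic`): for a finite Galois
extension `L/K` with CYCLIC Galois group and an irreducible `ρ : Γ_K → GL_n(k)` over an
algebraically closed field `k` of characteristic `0`,

* `isIrreducible_restrictField_or_exists_selfTwist` — EITHER `ρ|_{Γ_L}` is irreducible, OR `ρ` is
  SELF-TWISTED by a non-trivial character of `Gal(L/K)`: `ρ ≅ ρ ⊗ χ` for some `χ : Γ_K → kˣ`
  trivial on `res(Γ_L)`, `χ ≠ 1`, `χ ^ [L:K] = 1` (the cyclic presentation of `Γ_K ⊇ res(Γ_L)` is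
  `exists_cyclic_presentation_absGaloisRestrict`, p127434);
* `isIrreducible_restrictField_of_coprime` — consequently, if `gcd(n, [L:K]) = 1` then `ρ|_{Γ_L}` is
  irreducible OUTRIGHT: a self-twist `ρ ≅ ρ ⊗ χ` forces `χ ^ n = 1` (determinants,
  `Literature.RepresentationTheory.Semisimple.Representation.pow_finrank_eq_one_of_equiv_twist`),
  and `χ ^ n = χ ^ [L:K] = 1` with `gcd = 1` gives `χ = 1`.

So irreducibility of `ℓ`-adic (or Artin, or mod-nothing: any algebraically closed characteristic-0
coefficients) Galois representations ASCENDS along cyclic extensions of degree prime to the rank —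
e.g. `GL_2` along cubic cyclic extensions, odd rank along quadratic extensions (the parity case
`Literature.NumberTheory.GaloisRepresentations.Representation.isIrreducible_comp_of_index_two`,
which needs no algebraic closure) — and in general exactly when `ρ` admits no self-twist by the
characters of `Gal(L/K)` (for `GL_2` and `L/K` quadratic: `ρ` not induced from `Γ_L`).

References: A. H. Clifford, Ann. of Math. 38 (1937), Thms. 1–3; J. Arthur, L. Clozel, *Simple
algebras, base change, and the advanced theory of the trace formula* (1989), Ch. 3, Thm. 4.2 and
Lemma 6.3 (the automorphic mirror: `BC_{L/K}(π)` cuspidal iff `π ≇ π ⊗ η` for the characters `η` of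
`𝔸_K^×/K^× N_{L/K}𝔸_L^×`); G. Henniart, R. Herb, *Automorphic induction for GL(n, ℝ) and GL(n, ℂ)*,
§1 (Galois side).
-/

noncomputable section

-- `Summit.Langlands.Langlands.…` (summit = sub-problem name, D-0017 layout) trips `dupNamespace`.
set_option linter.dupNamespace false

open Literature.RepresentationTheory.Semisimple
open Literature.NumberTheory.GaloisRepresentations Field

namespace Summit.Langlands.Langlands.Theorems.IrreducibleOffSector

/-! ## Irreducibility along a homomorphism depends only on its image -/

section CompRange

variable {k : Type*} [Field k] {G H : Type*} [Group G] [Group H] {V : Type*} [AddCommGroup V]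
  [Module k V]

/-- Along a group homomorphism `f : H → G`, the representation `ρ ∘ f` of `H` is irreducible iff the
restriction of `ρ` to the subgroup `f(H) ≤ G` is: the subrepresentations of the two are the same
subspaces of `V` (those stable under the `ρ(f(h))`), so the two lattices are isomorphic
(Mathlib `OrderIso.isSimpleOrder_iff`; companion of the tree's
`Representation.isSemisimpleRepresentation_comp_iff_of_injective`). [folklore] -/
theorem isIrreducible_comp_iff_restrictSubgroup_range (ρ : Representation k G V) (f : H →* G) :
    Representation.IsIrreducible (ρ.comp f) ↔
      (Representation.restrictSubgroup ρ f.range).IsIrreducible :=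
  OrderIso.isSimpleOrder_iff
    { toFun := fun W ↦ ⟨W.toSubmodule, fun g v hv ↦ by
        obtain ⟨h, hh⟩ := g.2
        have h1 := W.apply_mem_toSubmodule h hv
        change ρ (g : G) v ∈ W.toSubmodule
        rw [← hh]
        exact h1⟩
      invFun := fun W ↦ ⟨W.toSubmodule, fun h v hv ↦ W.apply_mem_toSubmodule ⟨f h, h, rfl⟩ hv⟩
      left_inv := fun _ ↦ rfl
      right_inv := fun _ ↦ rfl
      map_rel_iff' := Iff.rfl }

end CompRange


/-! ## The dichotomy is exclusive -/

section Exclusive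

variable {k : Type*} [Field k] [IsAlgClosed k] {G : Type*} [Group G] {V : Type*} [AddCommGroup V]
  [Module k V] [FiniteDimensional k V]

/-- **The two cases of Clifford's dichotomy exclude each other.**  If the restriction `π|_N` of a
finite-dimensional representation `π` to a subgroup `N` is irreducible (over an algebraically
closed field), then `π` admits no self-twist by a non-trivial character trivial on `N`: an
isomorphism `T : π ≅ π ⊗ χ` commutes with `π(N)`, hence is a scalar `c ≠ 0` (Schur for `π|_N`),
and `c π(g) = χ(g) c π(g)` forces `χ(g) = 1`. [folklore] -/
theorem eq_one_of_equiv_twist_of_isIrreducible_restrict (π : Representation k G V)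
    (N : Subgroup G) (hN : (Representation.restrictSubgroup π N).IsIrreducible) (χ : G →* kˣ)
    (hχ : ∀ h ∈ N, χ h = 1) (e : π.Equiv (Representation.twist π χ)) : χ = 1 := by
  haveI := hN
  haveI : Nontrivial V :=
    Representation.nontrivial_of_isIrreducible (Representation.restrictSubgroup π N)
  -- `T = e` is an `N`-intertwiner of the irreducible `π|_N`, hence scalar
  let T : (Representation.restrictSubgroup π N).IntertwiningMap (Representation.restrictSubgroup π N) :=
    ⟨e.toLinearMap, fun n => by
      have h := e.isIntertwining' (n : G)
      have htw : (Representation.twist π χ) (n : G) = ((χ n : kˣ) : k) • π n := rfl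
      rw [htw, hχ _ n.2, Units.val_one, one_smul] at h
      exact h⟩
  obtain ⟨c, hc⟩ :=
    (Representation.IsIrreducible.algebraMap_intertwiningMap_bijective_of_isAlgClosed
      (ρ := Representation.restrictSubgroup π N)).2 T
  have hT : e.toLinearMap = c • LinearMap.id := by
    have hc' := congrArg Representation.IntertwiningMap.toLinearMap hc
    rw [Representation.IntertwiningMap.algebraMap_apply,
      Representation.IntertwiningMap.toLinearMap_smul] at hc'
    exact hc'.symm
  -- compare `T ∘ π g = χ g • π g ∘ T` with `T = c • id`
  refine MonoidHom.ext fun g => ?_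
  have h := e.isIntertwining' g
  have htw : (Representation.twist π χ) g = ((χ g : kˣ) : k) • π g := rfl
  rw [htw, hT, LinearMap.comp_smul, LinearMap.smul_comp, LinearMap.id_comp,
    LinearMap.comp_id, smul_smul] at h
  -- `c • π g = (χ g * c) • π g` with `π g ≠ 0` and `c ≠ 0`
  have hc0 : c ≠ 0 := by
    rintro rfl
    obtain ⟨v, hv⟩ := exists_ne (0 : V)
    apply hv
    have := congrArg (fun f : V →ₗ[k] V => f v) hT
    simp only [zero_smul, LinearMap.zero_apply] at this
    exact e.toLinearEquiv.injective (by rw [map_zero]; exact this)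
  have hπ0 : (π g : V →ₗ[k] V) ≠ 0 := by
    intro h0
    obtain ⟨v, hv⟩ := exists_ne (0 : V)
    apply hv
    have : π g⁻¹ (π g v) = v := by
      rw [← Module.End.mul_apply, ← map_mul, inv_mul_cancel, map_one, Module.End.one_apply]
    rw [← this, h0, LinearMap.zero_apply, map_zero]
  have h2 : (c - c * (χ g : k)) • (π g : V →ₗ[k] V) = 0 := by rw [sub_smul, ← h, sub_self]
  rw [smul_eq_zero, or_iff_left hπ0, sub_eq_zero] at h2
  rw [MonoidHom.one_apply]
  refine Units.val_eq_one.1 ?_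
  have h3 : c * ((χ g : k) - 1) = 0 := by rw [mul_sub, mul_one, ← h2, sub_self]
  rwa [mul_eq_zero, or_iff_right hc0, sub_eq_zero] at h3

end Exclusive

/-! ## Restriction to `Γ_L` for `L/K` cyclic -/

section Galois

/-- **Clifford's dichotomy for `ρ|_{Γ_L}`, `L/K` finite Galois with cyclic Galois group.**  Let `k`
be an algebraically closed field of characteristic `0` and `ρ : Γ_K → GL_n(k)` a continuous
representation with irreducible underlying representation.  Then EITHER the restriction
`ρ|_{Γ_L} = ρ ∘ res` (`FramedGaloisRep.restrictField`) has irreducible underlying representation, OR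
there is a character `χ : Γ_K → kˣ`, trivial on `res(Γ_L)` (so a character of
`Gal(L/K) ≅ Γ_K / res(Γ_L)`), non-trivial, with `χ ^ [L:K] = 1`, such that `ρ ≅ ρ ⊗ χ` as
representations of `Γ_K` (`ρ` is SELF-TWISTED by a non-trivial character of `Gal(L/K)`).
`clifford_cyclic` applied to the cyclic presentation of `Γ_K ⊇ res(Γ_L)`
(`exists_cyclic_presentation_absGaloisRestrict`).  Clifford 1937, Thms. 1–3; Arthur–Clozel (1989)
Ch. 3, Lemma 6.3 (Galois-side analogue). [cite: Clifford1937, Thm. 1] -/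
theorem isIrreducible_restrictField_or_exists_selfTwist {K L : Type*} [Field K] [Field L]
    [Algebra K L] [FiniteDimensional K L] [IsGalois K L] {k : Type*} [Field k] [IsAlgClosed k]
    [CharZero k] [TopologicalSpace k] [IsTopologicalRing k] {n : ℕ} (hcyc : IsCyclic (L ≃ₐ[K] L))
    (ρ : FramedGaloisRep K k n) (hρ : ρ.toGaloisRep.IsIrreducible) :
    (ρ.restrictField L).toGaloisRep.IsIrreducible ∨
      ∃ χ : absoluteGaloisGroup K →* kˣ,
        (∀ σ ∈ ((absGaloisRestrict K L).range : Subgroup (absoluteGaloisGroup K)), χ σ = 1) ∧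
        χ ≠ 1 ∧ (∀ σ, χ σ ^ Module.finrank K L = 1) ∧
        Nonempty ((FramedRep.toRepresentation ρ).Equiv
          (Representation.twist (FramedRep.toRepresentation ρ) χ)) := by
  obtain ⟨hN, g₀, hg₀, hgen⟩ := exists_cyclic_presentation_absGaloisRestrict K L hcyc
  haveI := hN
  have hm : ((Module.finrank K L : ℕ) : k) ≠ 0 := by exact_mod_cast Module.finrank_pos.ne'
  rcases clifford_cyclic (FramedRep.toRepresentation ρ) hρ _ hm hg₀ hgen with h | h
  · left
    change Representation.IsIrreducible ((ρ.restrictField L).toGaloisRep.toRepresentation)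
    rw [FramedGaloisRep.toRepresentation_restrictField, isIrreducible_comp_iff_restrictSubgroup_range]
    exact h
  · exact Or.inr h

/-- **Irreducibility ascends along cyclic extensions of degree prime to the rank.**  Let `L/K` be
finite Galois with cyclic Galois group and `gcd(n, [L:K]) = 1`.  If `ρ : Γ_K → GL_n(k)` (`k`
algebraically closed of characteristic `0`) has irreducible underlying representation, so has
`ρ|_{Γ_L}`: otherwise `ρ ≅ ρ ⊗ χ` with `χ ≠ 1`, `χ ^ [L:K] = 1`
(`isIrreducible_restrictField_or_exists_selfTwist`), while comparing determinants gives
`χ ^ n = 1` (`Representation.pow_finrank_eq_one_of_equiv_twist`), so `χ = χ ^ gcd(n, [L:K]) = 1`.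
(Examples: `GL_2` along cubic cyclic extensions; odd rank along quadratic extensions.)
[cite: Clifford1937, Thm. 1] -/
theorem isIrreducible_restrictField_of_coprime {K L : Type*} [Field K] [Field L] [Algebra K L]
    [FiniteDimensional K L] [IsGalois K L] {k : Type*} [Field k] [IsAlgClosed k] [CharZero k]
    [TopologicalSpace k] [IsTopologicalRing k] {n : ℕ} (hcyc : IsCyclic (L ≃ₐ[K] L))
    (hcop : Nat.Coprime n (Module.finrank K L)) (ρ : FramedGaloisRep K k n)
    (hρ : ρ.toGaloisRep.IsIrreducible) : (ρ.restrictField L).toGaloisRep.IsIrreducible := by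
  rcases isIrreducible_restrictField_or_exists_selfTwist hcyc ρ hρ with h | ⟨χ, -, hχ1, hχm, ⟨e⟩⟩
  · exact h
  · exfalso
    refine hχ1 (MonoidHom.ext fun σ => ?_)
    rw [MonoidHom.one_apply]
    have h1 : ((χ σ : kˣ) : k) ^ n = 1 := by
      have h := Representation.pow_finrank_eq_one_of_equiv_twist e σ
      rwa [Module.finrank_fin_fun] at h
    have h2 : ((χ σ : kˣ) : k) ^ Module.finrank K L = 1 := by
      rw [← Units.val_pow_eq_pow_val, hχm, Units.val_one]
    have h12 : ((χ σ : kˣ) : k) ^ n.gcd (Module.finrank K L) = 1 := pow_gcd_eq_one.2 ⟨h1, h2⟩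
    rw [Nat.Coprime.gcd_eq_one hcop, pow_one] at h12
    exact Units.val_eq_one.1 h12

end Galois

end Summit.Langlands.Langlands.Theorems.IrreducibleOffSector

end
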